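import Summits.RiemannHypothesis.RiemannHypothesis.Theorems.ScrewLemmaKProfileBernoulliMuentz
import Summits.RiemannHypothesis.RiemannHypothesis.Theorems.ScrewLemmaKProfileBernoulliDefs
import Summits.RiemannHypothesis.RiemannHypothesis.Theorems.ScrewLemmaKProfileBernoulliC2

/-!
# Continuation past the pole: the profile Mellin formula on `−1 < Re w < 0` for `C²` data (K1 support; v5 §5)

`A(w) := 𝓜(ψ·1_(0,1))(w)` is holomorphic on `Re w > −1`; `B(w) := −ζ(w)G(w)/w − h₀/w` is holomorphic off
`{0, 1}`; `A = B` on `Re w > 0` (Müntz + IBP); identity theorem on two convex pieces; finally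
`𝓜H(w) = −ζ(w)G(w)/w` for `−1 < Re w < 0`, `G(w) = ∫₀¹ g′(u)u^w du` — for `g ∈ C²[0,1]` with `g(1) = 0`, `∫g = 0`
(NO `u^{-1/2}`-moment needed; route SmoothSectorHardy's `profileMellinFormula_proof` is the admissible version with
a `MellinConvergent` proviso).  On `Re w = −½` this is literally the conclusion of L14's `ProfileMellinFormula`.

Ported verbatim (tree conventions: docstrings, ≤ 400-line files) from rh-idea-5 g0's desk file
`pub/ideators/rh-idea-5/ProfileBernoulli.lean` v5 (sha16 4e6baba130239d85, lean check rc 0), in support of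
item stmt-RiemannHypothesis-21612 `CoprofileIsometry` (K1 of route ScrewLemmaKCoprofile; shared with
ScrewLemmaKExtremalRay); §§1–3 are the tree's `ScrewLemmaKProfileBernoulli{,Defs,C2}` (k1-w3), §4 `…Muentz`.
RH-free real/complex analysis: this is NOT a proof of RH and nothing here bears on the truth of RH.
-/

noncomputable section

set_option linter.dupNamespace false

namespace Summit.RiemannHypothesis.RiemannHypothesis.Theorems.IntegerScrew.ProfileBernoulli

open MeasureTheory Set intervalIntegral
open Summit.RiemannHypothesis.RiemannHypothesis.Theorems.IntegerScrew
open scoped BigOperators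

open Summit.RiemannHypothesis.RiemannHypothesis.Theorems.SmoothSectorHardy (profileFun profileDev
  latticeProfile_eq_zero_of_one_lt latticeProfile_one)

/-! ## Continuation past the pole: the profile Mellin formula on `−1 < Re w < 0` (`C²` data)

`A(w) := 𝓜(ψ·1_(0,1))(w)` is holomorphic on `Re w > −1`; `B(w) := −ζ(w)G(w)/w − h₀/w` is holomorphic off
`{0, 1}`; `A = B` on `Re w > 0` by (a), (b) and `∫₀¹ y^{w−1} dy = 1/w`; identity theorem on the convex pieces
`{Re w > −1, Im w > 0}` and `{−1 < Re w < 0}`; finally `𝓜H(w) = A(w) + h₀/w = −ζ(w)G(w)/w` for `−1 < Re w < 0`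
using `∫₁^∞ y^{w−1} dy = −1/w`. -/

/-- `ψ·1_(0,1)` as a complex function on the line. [folklore] -/
def psiInd (g : ℝ → ℝ) : ℝ → ℂ := fun y =>
  (((Ioo (0:ℝ) 1).indicator (fun y => latticeProfile g y - latticePlateau g) y : ℝ) : ℂ)

/-- the generator transform `G(w) = ∫₀¹ g′(u) u^w du`. [folklore] -/
def genT (g : ℝ → ℝ) (w : ℂ) : ℂ := ∫ u in Ioo (0:ℝ) 1, ((deriv g u : ℝ) : ℂ) * (u : ℂ) ^ w


/-- `psiInd` is the cast-outside form of route SmoothSectorHardy's `profileDev` (`1_(0,1)·(h − h₀)`, complex-valued);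
the continuation lemmas below are keyed to `psiInd`, this records the identification. [folklore] -/
theorem psiInd_eq_profileDev (g : ℝ → ℝ) : psiInd g = profileDev g := by
  funext y
  unfold psiInd profileDev
  by_cases hy : y ∈ Ioo (0:ℝ) 1
  · rw [indicator_of_mem hy, indicator_of_mem hy]
  · rw [indicator_of_notMem hy, indicator_of_notMem hy, Complex.ofReal_zero]


/-- on `(0, ∞)`: `ψ·1_(0,1) = h − h₀·1_(0,1)` (uses `g(1) = 0`, `h = 0` on `(1, ∞)`). [folklore] -/
theorem psiInd_eq_sub {g : ℝ → ℝ} (h1 : g 1 = 0) {y : ℝ} (hy : 0 < y) :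
    psiInd g y = ((latticeProfile g y : ℝ) : ℂ)
      - ((latticePlateau g : ℝ) : ℂ) * (Ioo (0:ℝ) 1).indicator (fun _ => (1:ℂ)) y := by
  unfold psiInd
  by_cases hy1 : y ∈ Ioo (0:ℝ) 1
  · rw [indicator_of_mem hy1, indicator_of_mem hy1]; push_cast; ring
  · rw [indicator_of_notMem hy1, indicator_of_notMem hy1]
    have hy' : 1 ≤ y := by
      by_contra h; exact hy1 ⟨hy, not_le.mp h⟩
    rcases hy'.eq_or_lt with h | h
    · rw [← h, latticeProfile_one, h1]; simp
    · rw [latticeProfile_eq_zero_of_one_lt g h]; simp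

/-- measurable model of `ψ·1_(0,1)`. [folklore] -/
theorem psiInd_eq_indicator_psiInt {g : ℝ → ℝ} (hC : ContDiffOn ℝ 1 g (Icc 0 1)) (h1 : g 1 = 0)
    (hI : ∫ u in (0:ℝ)..1, g u = 0) :
    psiInd g = fun y => (((Ioo (0:ℝ) 1).indicator (psiInt g) y : ℝ) : ℂ) := by
  funext y
  unfold psiInd
  by_cases hy1 : y ∈ Ioo (0:ℝ) 1
  · rw [indicator_of_mem hy1, indicator_of_mem hy1, psiInt_eq hC h1 hI hy1.1]
  · rw [indicator_of_notMem hy1, indicator_of_notMem hy1]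

/-- `ψ·1_(0,1)` is measurable. [folklore] -/
theorem measurable_psiInd {g : ℝ → ℝ} (hC : ContDiffOn ℝ 1 g (Icc 0 1)) (h1 : g 1 = 0)
    (hI : ∫ u in (0:ℝ)..1, g u = 0) : Measurable (psiInd g) := by
  rw [psiInd_eq_indicator_psiInt hC h1 hI]
  exact Complex.measurable_ofReal.comp
    ((stronglyMeasurable_psiInt g).measurable.indicator measurableSet_Ioo)

/-- uniform bound `‖ψ·1_(0,1)(y)‖ ≤ ½∫₀¹|g′|`. [folklore] -/
theorem norm_psiInd_le {g : ℝ → ℝ} (hC : ContDiffOn ℝ 1 g (Icc 0 1)) (h1 : g 1 = 0)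
    (hI : ∫ u in (0:ℝ)..1, g u = 0) (y : ℝ) :
    ‖psiInd g y‖ ≤ (1 / 2) * ∫ u in (0:ℝ)..1, |deriv g u| := by
  unfold psiInd
  rw [Complex.norm_real, Real.norm_eq_abs]
  by_cases hy1 : y ∈ Ioo (0:ℝ) 1
  · rw [indicator_of_mem hy1]; exact abs_profile_sub_plateau_le hC h1 hI hy1.1
  · rw [indicator_of_notMem hy1, abs_zero]
    have : 0 ≤ ∫ u in (0:ℝ)..1, |deriv g u| :=
      intervalIntegral.integral_nonneg zero_le_one fun u _ => abs_nonneg _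
    positivity

/-- `ψ·1_(0,1)` is locally integrable on `(0,∞)`. [folklore] -/
theorem locallyIntegrableOn_psiInd {g : ℝ → ℝ} (hC : ContDiffOn ℝ 1 g (Icc 0 1)) (h1 : g 1 = 0)
    (hI : ∫ u in (0:ℝ)..1, g u = 0) : LocallyIntegrableOn (psiInd g) (Ioi 0) := by
  rw [locallyIntegrableOn_iff isOpen_Ioi.isLocallyClosed]
  intro k _ hkc
  exact IntegrableOn.of_bound hkc.measure_lt_top (measurable_psiInd hC h1 hI).aestronglyMeasurable _
    (Filter.Eventually.of_forall fun y => norm_psiInd_le hC h1 hI y)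

/-- `ψ·1_(0,1)` vanishes beyond `1`, so it is `O(y^{-a})` at `∞` for every `a`. [folklore] -/
theorem psiInd_isBigO_atTop (g : ℝ → ℝ) (a : ℝ) :
    (psiInd g) =O[Filter.atTop] (fun y : ℝ => y ^ (-a)) := by
  apply Asymptotics.IsBigO.of_bound 1
  filter_upwards [Filter.eventually_ge_atTop (1:ℝ)] with y hy
  have hy1 : y ∉ Ioo (0:ℝ) 1 := fun h => (not_lt.mpr hy) h.2
  simp only [psiInd, indicator_of_notMem hy1, Complex.ofReal_zero, norm_zero]
  positivity

/-- `ψ·1_(0,1) = O(y)` at `0⁺` for `C²` data. [folklore] -/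
theorem psiInd_isBigO_nhds_zero {g : ℝ → ℝ} (hC2 : ContDiffOn ℝ 2 g (Icc 0 1)) (h1 : g 1 = 0)
    (hI : ∫ u in (0:ℝ)..1, g u = 0) :
    (psiInd g) =O[nhdsWithin 0 (Ioi 0)] (fun y : ℝ => y ^ (-(-1:ℝ))) := by
  obtain ⟨C, _, hCy⟩ := exists_profile_sub_plateau_le_mul hC2 h1 hI
  apply Asymptotics.IsBigO.of_bound C
  filter_upwards [Ioo_mem_nhdsGT zero_lt_one] with y hy
  simp only [psiInd, indicator_of_mem hy, neg_neg, Real.rpow_one, Complex.norm_real, Real.norm_eq_abs,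
    abs_of_pos hy.1]
  exact hCy y hy.1

/-- `A(w) = 𝓜(ψ·1_(0,1))(w)` converges and is holomorphic on `Re w > −1` (`C²` data). [folklore] -/
theorem mellinConvergent_psiInd {g : ℝ → ℝ} (hC2 : ContDiffOn ℝ 2 g (Icc 0 1)) (h1 : g 1 = 0)
    (hI : ∫ u in (0:ℝ)..1, g u = 0) {w : ℂ} (hw : -1 < w.re) : MellinConvergent (psiInd g) w :=
  mellinConvergent_of_isBigO_rpow (locallyIntegrableOn_psiInd (hC2.of_le (by norm_num)) h1 hI)
    (psiInd_isBigO_atTop g (w.re + 1)) (by linarith) (psiInd_isBigO_nhds_zero hC2 h1 hI)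
    (by simpa using hw)

/-- `𝓜(ψ·1_(0,1))` is holomorphic on `Re w > −1` (`C²` data). [folklore] -/
theorem differentiableAt_mellin_psiInd {g : ℝ → ℝ} (hC2 : ContDiffOn ℝ 2 g (Icc 0 1)) (h1 : g 1 = 0)
    (hI : ∫ u in (0:ℝ)..1, g u = 0) {w : ℂ} (hw : -1 < w.re) :
    DifferentiableAt ℂ (mellin (psiInd g)) w :=
  mellin_differentiableAt_of_isBigO_rpow (locallyIntegrableOn_psiInd (hC2.of_le (by norm_num)) h1 hI)
    (psiInd_isBigO_atTop g (w.re + 1)) (by linarith) (psiInd_isBigO_nhds_zero hC2 h1 hI)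
    (by simpa using hw)

/-- the generator transform is a shifted Mellin transform of `g′·1_(0,1]`. [folklore] -/
theorem genT_eq_mellin (g : ℝ → ℝ) (w : ℂ) :
    genT g w = mellin ((Ioc (0:ℝ) 1).indicator fun u => ((deriv g u : ℝ) : ℂ)) (w + 1) := by
  rw [genT, mellin, add_sub_cancel_right]
  have e : ∀ t : ℝ, (t : ℂ) ^ w • (Ioc (0:ℝ) 1).indicator (fun u => ((deriv g u : ℝ) : ℂ)) t
      = (Ioc (0:ℝ) 1).indicator (fun u => ((deriv g u : ℝ) : ℂ) * (u : ℂ) ^ w) t := by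
    intro t
    by_cases ht : t ∈ Ioc (0:ℝ) 1
    · rw [indicator_of_mem ht, indicator_of_mem ht, smul_eq_mul, mul_comm]
    · rw [indicator_of_notMem ht, indicator_of_notMem ht, smul_zero]
  simp_rw [e]
  rw [setIntegral_indicator measurableSet_Ioc,
    show Ioi (0:ℝ) ∩ Ioc 0 1 = Ioc 0 1 from inter_eq_right.mpr fun u hu => hu.1,
    integral_Ioc_eq_integral_Ioo]

/-- the generator transform `G` is holomorphic on `Re w > −1`. [folklore] -/
theorem differentiableAt_genT {g : ℝ → ℝ} (hC : ContDiffOn ℝ 1 g (Icc 0 1)) {w : ℂ} (hw : -1 < w.re) :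
    DifferentiableAt ℂ (genT g) w := by
  set F : ℝ → ℂ := (Ioc (0:ℝ) 1).indicator fun u => ((deriv g u : ℝ) : ℂ) with hF
  have hFon : IntegrableOn (fun u => ((deriv g u : ℝ) : ℂ)) (Ioc (0:ℝ) 1) :=
    MeasureTheory.Integrable.ofReal (intervalIntegrable_deriv hC).1
  have hFint : Integrable F := hFon.integrable_indicator measurableSet_Ioc
  have hFloc : LocallyIntegrableOn F (Ioi 0) := hFint.locallyIntegrable.locallyIntegrableOn _
  have hFtop : F =O[Filter.atTop] (fun y : ℝ => y ^ (-((w + 1).re + 1))) := by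
    apply Asymptotics.IsBigO.of_bound 1
    filter_upwards [Filter.eventually_gt_atTop (1:ℝ)] with y hy
    have hy1 : y ∉ Ioc (0:ℝ) 1 := fun h => (not_lt.mpr h.2) hy
    simp only [hF, indicator_of_notMem hy1, norm_zero]
    positivity
  obtain ⟨M, hM⟩ := isCompact_Icc.exists_bound_of_continuousOn (continuousOn_derivWithin_Icc hC)
  have hFbot : F =O[nhdsWithin 0 (Ioi 0)] (fun y : ℝ => y ^ (-(0:ℝ))) := by
    apply Asymptotics.IsBigO.of_bound M
    filter_upwards [Ioo_mem_nhdsGT zero_lt_one] with y hy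
    have hy' : y ∈ Ioc (0:ℝ) 1 := ⟨hy.1, hy.2.le⟩
    simp only [hF, indicator_of_mem hy', neg_zero, Real.rpow_zero, norm_one, mul_one, Complex.norm_real]
    rw [← derivWithin_eq_deriv_of_mem hy]
    exact hM y ⟨hy.1.le, hy.2.le⟩
  have hmd : DifferentiableAt ℂ (mellin F) (w + 1) :=
    mellin_differentiableAt_of_isBigO_rpow hFloc hFtop (by simp) hFbot (by simp; linarith)
  have hfun : genT g = (mellin F) ∘ (fun z : ℂ => z + 1) := funext fun z => genT_eq_mellin g z
  rw [hfun]
  exact DifferentiableAt.comp w hmd ((differentiableAt_id (𝕜 := ℂ) (x := w)).add_const (1:ℂ))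

/-- (c1) on `Re w > 0`, `w ≠ 1`: `A(w) = −ζ(w)G(w)/w − h₀/w`. [folklore] -/
theorem mellin_psiInd_eq_of_pos {g : ℝ → ℝ} (hC : ContDiffOn ℝ 1 g (Icc 0 1)) (h1 : g 1 = 0)
    (hI : ∫ u in (0:ℝ)..1, g u = 0) {w : ℂ} (hw : 0 < w.re) (hw1 : w ≠ 1) :
    mellin (psiInd g) w = -(riemannZeta w) * genT g w / w - ((latticePlateau g : ℝ) : ℂ) / w := by
  have hw0 : w ≠ 0 := by
    intro h; rw [h] at hw; simp at hw
  obtain ⟨hM, hMe⟩ := mellin_latticeProfile hC hI hw hw1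
  rw [mellin_indicator_eq_generator hC h1 hw] at hMe
  -- the indicator integrand
  have hJint : IntegrableOn (fun t : ℝ => (Ioo (0:ℝ) 1).indicator (fun t : ℝ => (t : ℂ) ^ (w - 1)) t)
      (Ioi 0) := by
    have h0 : IntegrableOn (fun t : ℝ => (t : ℂ) ^ (w - 1)) (Ioo (0:ℝ) 1) :=
      ((intervalIntegrable_cpow' (a := 0) (b := 1) (by simp; linarith)).1).mono_set Ioo_subset_Ioc_self
    exact (h0.integrable_indicator measurableSet_Ioo).integrableOn
  have hJ : (∫ t in Ioi (0:ℝ), (Ioo (0:ℝ) 1).indicator (fun t : ℝ => (t : ℂ) ^ (w - 1)) t) = 1 / w := by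
    rw [setIntegral_indicator measurableSet_Ioo,
      show Ioi (0:ℝ) ∩ Ioo 0 1 = Ioo 0 1 from inter_eq_right.mpr fun u hu => hu.1,
      ← integral_Ioc_eq_integral_Ioo, ← intervalIntegral.integral_of_le zero_le_one,
      integral_cpow (Or.inl (by simp; linarith))]
    simp only [sub_add_cancel, Complex.ofReal_one, Complex.one_cpow, Complex.ofReal_zero,
      Complex.zero_cpow hw0, sub_zero]
  -- pointwise identity of the Mellin integrands on (0, ∞)
  have hpt : EqOn (fun t : ℝ => (t : ℂ) ^ (w - 1) • psiInd g t)
      (fun t : ℝ => (t : ℂ) ^ (w - 1) • ((latticeProfile g t : ℝ) : ℂ)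
        - ((latticePlateau g : ℝ) : ℂ) * (Ioo (0:ℝ) 1).indicator (fun t : ℝ => (t : ℂ) ^ (w - 1)) t)
      (Ioi 0) := by
    intro t ht
    simp only [psiInd_eq_sub h1 ht, smul_eq_mul]
    by_cases ht1 : t ∈ Ioo (0:ℝ) 1
    · rw [indicator_of_mem ht1, indicator_of_mem ht1]; ring
    · rw [indicator_of_notMem ht1, indicator_of_notMem ht1]; ring
  rw [mellin, setIntegral_congr_fun measurableSet_Ioi hpt, integral_sub hM (hJint.const_mul _),
    MeasureTheory.integral_const_mul, hJ]
  have hMe' : (∫ a in Ioi (0:ℝ), (a : ℂ) ^ (w - 1) • ((latticeProfile g a : ℝ) : ℂ))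
      = riemannZeta w * (-(1 / w) * ∫ u in Ioo (0:ℝ) 1, ((deriv g u : ℝ) : ℂ) * (u : ℂ) ^ w) := hMe
  rw [hMe', genT]
  field_simp

/-- (c2) `B(w) := −ζ(w)G(w)/w − h₀/w` is holomorphic on `Re w > −1` off `{0, 1}`. [folklore] -/
theorem differentiableAt_B {g : ℝ → ℝ} (hC : ContDiffOn ℝ 1 g (Icc 0 1)) {w : ℂ} (hw : -1 < w.re)
    (hw0 : w ≠ 0) (hw1 : w ≠ 1) :
    DifferentiableAt ℂ (fun z => -(riemannZeta z) * genT g z / z - ((latticePlateau g : ℝ) : ℂ) / z) w :=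
  (((differentiableAt_riemannZeta hw1).neg.mul (differentiableAt_genT hC hw)).div differentiableAt_id
    hw0).sub ((differentiableAt_const _).div differentiableAt_id hw0)

/-- (c3) CONTINUATION: `A(w) = −ζ(w)G(w)/w − h₀/w` on the whole strip `−1 < Re w < 0` (`C²` data). [folklore] -/
theorem mellin_psiInd_eq_of_neg {g : ℝ → ℝ} (hC2 : ContDiffOn ℝ 2 g (Icc 0 1)) (h1 : g 1 = 0)
    (hI : ∫ u in (0:ℝ)..1, g u = 0) {w : ℂ} (hw1 : -1 < w.re) (hw2 : w.re < 0) :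
    mellin (psiInd g) w = -(riemannZeta w) * genT g w / w - ((latticePlateau g : ℝ) : ℂ) / w := by
  have hC1 : ContDiffOn ℝ 1 g (Icc 0 1) := hC2.of_le (by norm_num)
  set f : ℂ → ℂ := mellin (psiInd g) with hf_def
  set gB : ℂ → ℂ := fun z => -(riemannZeta z) * genT g z / z - ((latticePlateau g : ℝ) : ℂ) / z
    with hgB_def
  change f w = gB w
  have hf_diff : ∀ z : ℂ, -1 < z.re → DifferentiableAt ℂ f z := fun z hz =>
    differentiableAt_mellin_psiInd hC2 h1 hI hz
  have hg_diff : ∀ z : ℂ, -1 < z.re → z ≠ 0 → z ≠ 1 → DifferentiableAt ℂ gB z := fun z hz hz0 hz1 =>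
    differentiableAt_B hC1 hz hz0 hz1
  have hbase : ∀ z : ℂ, 0 < z.re → z ≠ 1 → f z = gB z := fun z hz hz1 =>
    mellin_psiInd_eq_of_pos hC1 h1 hI hz hz1
  -- identity theorem on a convex open piece avoiding `0, 1`
  have key : ∀ U : Set ℂ, IsOpen U → Convex ℝ U → (∀ z ∈ U, -1 < z.re ∧ z ≠ 0 ∧ z ≠ 1) →
      ∀ z₀ ∈ U, f =ᶠ[nhds z₀] gB → EqOn f gB U := by
    intro U hUo hUc hUS z₀ hz₀ hfg
    have hfU : AnalyticOnNhd ℂ f U :=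
      DifferentiableOn.analyticOnNhd
        (fun z hz => (hf_diff z (hUS z hz).1).differentiableWithinAt) hUo
    have hgU : AnalyticOnNhd ℂ gB U :=
      DifferentiableOn.analyticOnNhd
        (fun z hz => (hg_diff z (hUS z hz).1 (hUS z hz).2.1 (hUS z hz).2.2).differentiableWithinAt) hUo
    exact hfU.eqOn_of_preconnected_of_eventuallyEq hgU hUc.isPreconnected hz₀ hfg
  -- base region: open right half-plane minus nothing (we use the quadrant `Re z > 0, Im z > 0`)
  have hW_open : IsOpen ({z : ℂ | 0 < z.re} ∩ {z : ℂ | 0 < z.im}) :=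
    (isOpen_lt continuous_const Complex.continuous_re).inter (isOpen_lt continuous_const Complex.continuous_im)
  have hW_eq : EqOn f gB ({z : ℂ | 0 < z.re} ∩ {z : ℂ | 0 < z.im}) := fun z hz =>
    hbase z hz.1 (fun h => by
      have h2 : 0 < z.im := hz.2; rw [h, Complex.one_im] at h2; exact lt_irrefl _ h2)
  -- upper piece `Re z > −1, Im z > 0`
  have hUp : EqOn f gB ({z : ℂ | -1 < z.re} ∩ {z : ℂ | 0 < z.im}) := by
    have hUo : IsOpen ({z : ℂ | -1 < z.re} ∩ {z : ℂ | 0 < z.im}) :=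
      (isOpen_lt continuous_const Complex.continuous_re).inter (isOpen_lt continuous_const Complex.continuous_im)
    have hUc : Convex ℝ ({z : ℂ | -1 < z.re} ∩ {z : ℂ | 0 < z.im}) :=
      (convex_halfSpace_re_gt _).inter (convex_halfSpace_im_gt _)
    set z₀ : ℂ := ⟨1, 1⟩ with hz₀
    have hz₀U : z₀ ∈ {z : ℂ | -1 < z.re} ∩ {z : ℂ | 0 < z.im} :=
      ⟨by show (-1:ℝ) < 1; norm_num, by show (0:ℝ) < 1; norm_num⟩
    refine key _ hUo hUc (fun z hz => ⟨hz.1, ?_, ?_⟩) z₀ hz₀U ?_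
    · intro h; have h2 : 0 < z.im := hz.2; rw [h, Complex.zero_im] at h2; exact lt_irrefl _ h2
    · intro h; have h2 : 0 < z.im := hz.2; rw [h, Complex.one_im] at h2; exact lt_irrefl _ h2
    · exact Filter.eventuallyEq_of_mem (hW_open.mem_nhds ⟨by show (0:ℝ) < 1; norm_num,
        by show (0:ℝ) < 1; norm_num⟩) hW_eq
  -- left strip `−1 < Re z < 0`
  have hV : EqOn f gB ({z : ℂ | -1 < z.re} ∩ {z : ℂ | z.re < 0}) := by
    have hUo : IsOpen ({z : ℂ | -1 < z.re} ∩ {z : ℂ | z.re < 0}) :=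
      (isOpen_lt continuous_const Complex.continuous_re).inter (isOpen_lt Complex.continuous_re continuous_const)
    have hUc : Convex ℝ ({z : ℂ | -1 < z.re} ∩ {z : ℂ | z.re < 0}) :=
      (convex_halfSpace_re_gt _).inter (convex_halfSpace_re_lt _)
    set z₁ : ℂ := ⟨-(1 / 2), 1⟩ with hz₁
    have hz₁V : z₁ ∈ {z : ℂ | -1 < z.re} ∩ {z : ℂ | z.re < 0} :=
      ⟨by show (-1:ℝ) < -(1 / 2); norm_num, by show (-(1 / 2) : ℝ) < 0; norm_num⟩
    have hUpo : IsOpen ({z : ℂ | -1 < z.re} ∩ {z : ℂ | 0 < z.im}) :=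
      (isOpen_lt continuous_const Complex.continuous_re).inter (isOpen_lt continuous_const Complex.continuous_im)
    refine key _ hUo hUc (fun z hz => ⟨hz.1, ?_, ?_⟩) z₁ hz₁V ?_
    · intro h; have h2 : z.re < 0 := hz.2; rw [h, Complex.zero_re] at h2; exact lt_irrefl _ h2
    · intro h; have h2 : z.re < 0 := hz.2; rw [h, Complex.one_re] at h2; linarith
    · exact Filter.eventuallyEq_of_mem (hUpo.mem_nhds ⟨by show (-1:ℝ) < -(1 / 2); norm_num,
        by show (0:ℝ) < 1; norm_num⟩) hUp
  exact hV ⟨hw1, hw2⟩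

/-- THE PROFILE MELLIN FORMULA (`C²` data): for `−1 < Re w < 0`,
`𝓜H(w) = ζ(w)/w · (−∫₀¹ g′(u) u^w du)` where `H = (h − h₀)·1_(0,1) − h₀·1_[1,∞)` (= `profileFun g`). [folklore] -/
theorem mellin_profileFun_eq {g : ℝ → ℝ} (hC2 : ContDiffOn ℝ 2 g (Icc 0 1)) (h1 : g 1 = 0)
    (hI : ∫ u in (0:ℝ)..1, g u = 0) {w : ℂ} (hw1 : -1 < w.re) (hw2 : w.re < 0) :
    mellin (profileFun g) w
      = riemannZeta w / w * -(∫ u in Ioo (0:ℝ) 1, ((deriv g u : ℝ) : ℂ) * (u : ℂ) ^ w) := by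
  have hw0 : w ≠ 0 := by
    intro h; rw [h] at hw2; simp at hw2
  have hA := mellin_psiInd_eq_of_neg hC2 h1 hI hw1 hw2
  have hAconv := mellinConvergent_psiInd hC2 h1 hI hw1
  -- the tail `h₀·1_[1,∞)`
  have hTint : IntegrableOn (fun t : ℝ => (Ici (1:ℝ)).indicator (fun t : ℝ => (t : ℂ) ^ (w - 1)) t)
      (Ioi 0) := by
    have h0 : IntegrableOn (fun t : ℝ => (t : ℂ) ^ (w - 1)) (Ici (1:ℝ)) := by
      rw [integrableOn_congr_set_ae (Ioi_ae_eq_Ici (a := (1:ℝ))).symm]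
      exact integrableOn_Ioi_cpow_of_lt (by simp; linarith) zero_lt_one
    exact (h0.integrable_indicator measurableSet_Ici).integrableOn
  have hT : (∫ t in Ioi (0:ℝ), (Ici (1:ℝ)).indicator (fun t : ℝ => (t : ℂ) ^ (w - 1)) t) = -(1 / w) := by
    rw [setIntegral_indicator measurableSet_Ici,
      show Ioi (0:ℝ) ∩ Ici 1 = Ici 1 from
        inter_eq_right.mpr fun u hu => Set.mem_Ioi.mpr (lt_of_lt_of_le zero_lt_one (Set.mem_Ici.mp hu)),
      setIntegral_congr_set (Ioi_ae_eq_Ici (a := (1:ℝ))).symm,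
      integral_Ioi_cpow_of_lt (by simp; linarith) zero_lt_one]
    simp only [sub_add_cancel, Complex.ofReal_one, Complex.one_cpow]
    field_simp
  have hpt : EqOn (fun t : ℝ => (t : ℂ) ^ (w - 1) • profileFun g t)
      (fun t : ℝ => (t : ℂ) ^ (w - 1) • psiInd g t
        - ((latticePlateau g : ℝ) : ℂ) * (Ici (1:ℝ)).indicator (fun t : ℝ => (t : ℂ) ^ (w - 1)) t)
      (Ioi 0) := by
    intro t _
    simp only [profileFun, psiInd, smul_eq_mul, Complex.ofReal_sub]
    by_cases ht1 : t ∈ Ici (1:ℝ)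
    · rw [indicator_of_mem ht1, indicator_of_mem ht1]; ring
    · rw [indicator_of_notMem ht1, indicator_of_notMem ht1]; push_cast; ring
  rw [mellin, setIntegral_congr_fun measurableSet_Ioi hpt, integral_sub hAconv (hTint.const_mul _),
    MeasureTheory.integral_const_mul, hT]
  have hA' : (∫ a in Ioi (0:ℝ), (a : ℂ) ^ (w - 1) • psiInd g a)
      = -(riemannZeta w) * genT g w / w - ((latticePlateau g : ℝ) : ℂ) / w := hA
  rw [hA', genT]
  field_simp
  ring

/-- The formula on the line `Re w = −½` for an admissible `C²` generator — literally the conclusion of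
route item `SmoothSectorHardy.ProfileMellinFormula` (stmt 21565) for such `g`. [folklore] -/
theorem mellin_profileFun_half_eq {g : ℝ → ℝ} (hg : SmoothSectorAdmissible g)
    (hC2 : ContDiffOn ℝ 2 g (Icc 0 1)) (t : ℝ) :
    mellin (fun y : ℝ => (((Set.Ioo (0:ℝ) 1).indicator (fun y => latticeProfile g y - latticePlateau g) y
      - (Set.Ici (1:ℝ)).indicator (fun _ => latticePlateau g) y : ℝ) : ℂ)) (-(1 / 2 : ℂ) + t * Complex.I)
      = riemannZeta (-(1 / 2 : ℂ) + t * Complex.I) / (-(1 / 2 : ℂ) + t * Complex.I)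
        * -(∫ u in Set.Ioo (0:ℝ) 1, ((deriv g u : ℝ) : ℂ) * (u : ℂ) ^ (-(1 / 2 : ℂ) + t * Complex.I)) :=
  mellin_profileFun_eq hC2 hg.2.1 hg.2.2.1 (by norm_num) (by norm_num)


end Summit.RiemannHypothesis.RiemannHypothesis.Theorems.IntegerScrew.ProfileBernoulli

end
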